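import Literature.AlgebraicGeometry.GroupSchemes.BarsottiTateGroupFixedPart
import HarnessLib

/-!
# Functoriality of the fixed part `Fix ε ⊆ B` of an idempotent endomorphism of a Barsotti–Tate group

Topic `Literature/AlgebraicGeometry/GroupSchemes`; namespace `Literature.AlgebraicGeometry.GroupSchemes.BTGroup.Hom`.  Cell
`hodgecm-mathlib` (D-0151), FLOOR 0, P6 «MOD programme» (crux hLiu418 = stmt-HodgeConjecture-24832), organ **(O-BTε) «BT GROUP OF AN
IDEMPOTENT — FUNCTORIALITY»** dealt by the K∕BT desk F0P6d-plan (2026-09-01T14:56:39Z) for the HEART-fields of `stub_MH` ED. 3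
(F0P6a-plan: «`𝒢_y := ` the `w`-primary summand of `𝒜_y[p^∞]` cut by the idempotent `e_w ∈ 𝒪_F ⊗ ℤ_p`, WITH its `𝒪_{F,w}`-action»).
The carrier is ★ `BTGroup.Hom.fixBTGroup` (sibling `BarsottiTateGroupFixedPart`: the layers `Fix ε_n`, Tate's axioms, the inclusion
`fixBTGroupι`; the rank function is supplied over a local base by ★ `BarsottiTateGroupFixedPartHeight`).  THIS FILE adds the two
morphisms every consumer needs: the RETRACTION `B → Fix ε` (so that `Fix ε` is a direct summand: `ι ≫ r = 𝟙`, `r ≫ ι = ε`) and the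
RESTRICTION to fixed parts of a homomorphism commuting with the idempotents (so that a ring action `𝒪 → End B` commuting with `ε` —
e.g. `𝒪_{F,w}` acting on `A[p^∞]` through `ι` — restricts to `Fix ε = ε A[p^∞]`, and an isogeny compatible with `ε` induces a
homomorphism of the `w`-parts), with functoriality.  Two `def`s (`fixBTGroupRetract`, `fixRestrict`) + theorems; no named fact, no
instance, no notation, no `sorry`.  HC_CM is proved only modulo the printed citations until rung 0 closes; nothing here is about HC.

THE PRINT.  [Tate1967] §2 (2.1)–(2.2): homomorphisms of `p`-divisible groups are compatible systems of homomorphisms of the layers;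
(2.2)ff.∕[RapoportSmithlingZhang2020Diagonal] §4.1 (p. 17) «(dec pdiv)»: the decomposition `A[p^∞] = ∏_{w∣p} A[w^∞]` by the
idempotents of `𝒪_F ⊗ ℤ_p`, functorial in `𝒪_F`-linear isogenies and carrying the `𝒪_{F,w}`-actions.  [GortzWedhorn2020] Def. 4.45 (2)
(p. 117): kernels ∕ fixed subgroup schemes and their functoriality (★ `IdempotentSplitting.fixMap`, `fixRetract`).

* §1 **`fixBTGroupRetract ε hε h₁ hrank : Hom B (Fix ε)`** (layers ★ `fixRetract (ε.app n)`), `fixBTGroupι_comp_fixBTGroupRetract`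
  (`ι ≫ r = id`), `fixBTGroupRetract_comp_fixBTGroupι` (`r ≫ ι = ε`), `comp_fixBTGroupι_injective` (maps into `Fix ε` are determined
  after `ι`).
* §2 **`fixRestrict φ hφ : Hom (Fix ε) (Fix ε′)`** for `φ : Hom B B′` with `φ_n ≫ ε′_n = ε_n ≫ φ_n` (layers ★ `fixMap`),
  `fixRestrict_app_comp_fixLayerι`, `fixRestrict_comp_fixBTGroupι` (`res φ ≫ ι′ = ι ≫ φ`), `fixBTGroupRetract_comp_fixRestrict`
  (`r ≫ res φ = φ ≫ r′`), `fixRestrict_eq_comp` (`res φ = ι ≫ φ ≫ r′`), `fixRestrict_id`, `fixRestrict_comp` (functoriality).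

## References
* [Tate1967] J. T. Tate, *p-divisible groups* (Driebergen 1966), Springer 1967 — §2, (2.1)–(2.2).
* [RapoportSmithlingZhang2020Diagonal] M. Rapoport, B. Smithling, W. Zhang, Compos. Math. 156 (2020) — §4.1 (p. 17), «(dec pdiv)».
* [GortzWedhorn2020] U. Görtz, T. Wedhorn, *Algebraic Geometry I*, 2nd ed. (2020) — Definition 4.45 (2) (p. 117).
-/

noncomputable section

universe u

open CategoryTheory CategoryTheory.Limits AlgebraicGeometry MonoidalCategory CartesianMonoidalCategory
open scoped MonObj

namespace Literature.AlgebraicGeometry.GroupSchemes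

namespace BTGroup

namespace Hom

variable {S : Scheme.{u}} {p h h' h'' : ℕ} {B : BTGroup S p h} {B' : BTGroup S p h'} {B'' : BTGroup S p h''}

/-! ## §1 The retraction `B → Fix ε` -/

section Retract

variable (ε : Hom B B) (hε : ∀ n, ε.app n ≫ ε.app n = ε.app n) (h₁ : ℕ)
  (hrank : ∀ n (s : S), (ε.fixLayer n).hom.finrank s = p ^ (n * h₁))

/-- **The retraction `r : B → Fix ε`** of Barsotti–Tate groups defined by the idempotent `ε` itself: layers ★ `fixRetract (ε_n)`
(homomorphisms, ★ `isMonHom_fixRetract`), compatible with the transitions because `incl ≫ ε_{n+1} = ε_n ≫ incl` (★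
`fixRetract_comp_fixMap`). [cite: Tate1967, §2 (2.1)] [cite: GortzWedhorn2020, Definition 4.45 (2) (p. 117)] -/
def fixBTGroupRetract : Hom B (ε.fixBTGroup hε h₁ hrank) where
  app n :=
    letI := B.grpObj n
    IdempotentSplitting.fixRetract (ε.app n) (hε n)
  isMonHom_app n := by
    letI := B.grpObj n
    haveI := B.comm n
    haveI := ε.isMonHom_app n
    exact IdempotentSplitting.isMonHom_fixRetract (ε.app n) (hε n)
  incl_comp_app n := by
    letI := B.grpObj n
    letI := B.grpObj (n + 1)
    exact (IdempotentSplitting.fixRetract_comp_fixMap (ε.app n) (ε.app (n + 1)) (B.incl n) (hε n) (hε (n + 1))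
      (ε.incl_comp_app n)).symm

/-- Unfolding: the layers of the retraction are the `fixRetract (ε_n)`. [cite: Tate1967, §2 (2.1)] -/
@[simp] theorem fixBTGroupRetract_app (n : ℕ) :
    (ε.fixBTGroupRetract hε h₁ hrank).app n = letI := B.grpObj n; IdempotentSplitting.fixRetract (ε.app n) (hε n) := rfl

/-- **`ι ≫ r = 𝟙`**: `Fix ε` is a retract of `B`. [cite: Tate1967, §2 (2.1)] [cite: GortzWedhorn2020, Definition 4.45 (2) (p. 117)] -/
@[simp] theorem fixBTGroupι_comp_fixBTGroupRetract :
    (ε.fixBTGroupι hε h₁ hrank).comp (ε.fixBTGroupRetract hε h₁ hrank) = Hom.id _ := by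
  refine Hom.ext fun n => ?_
  letI := B.grpObj n
  rw [comp_app, id_app, fixBTGroupι_app, fixBTGroupRetract_app]
  exact IdempotentSplitting.fixι_fixRetract (ε.app n) (hε n)

/-- **`r ≫ ι = ε`**. [cite: Tate1967, §2 (2.1)] [cite: GortzWedhorn2020, Definition 4.45 (2) (p. 117)] -/
@[simp] theorem fixBTGroupRetract_comp_fixBTGroupι :
    (ε.fixBTGroupRetract hε h₁ hrank).comp (ε.fixBTGroupι hε h₁ hrank) = ε := by
  refine Hom.ext fun n => ?_
  letI := B.grpObj n
  rw [comp_app, fixBTGroupι_app, fixBTGroupRetract_app]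
  exact IdempotentSplitting.fixRetract_ι (ε.app n) (hε n)

/-- Homomorphisms INTO `Fix ε` are determined by their composite with `ι : Fix ε → B` (the layers `ι_n` are monomorphisms).
[cite: Tate1967, §2 (2.1)] -/
theorem comp_fixBTGroupι_injective {h₀ : ℕ} {B₀ : BTGroup S p h₀} {F G : Hom B₀ (ε.fixBTGroup hε h₁ hrank)}
    (hFG : F.comp (ε.fixBTGroupι hε h₁ hrank) = G.comp (ε.fixBTGroupι hε h₁ hrank)) : F = G := by
  refine Hom.ext fun n => ?_
  haveI := ε.mono_fixLayerι n
  have h := congrArg (fun K => Hom.app K n) hFG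
  simp only [comp_app, fixBTGroupι_app] at h
  exact (cancel_mono (ε.fixLayerι n)).mp h

end Retract

/-! ## §2 Restriction of a homomorphism commuting with the idempotents -/

section Restrict

variable (ε : Hom B B) (hε : ∀ n, ε.app n ≫ ε.app n = ε.app n) (h₁ : ℕ)
  (hrank : ∀ n (s : S), (ε.fixLayer n).hom.finrank s = p ^ (n * h₁))
  (ε' : Hom B' B') (hε' : ∀ n, ε'.app n ≫ ε'.app n = ε'.app n) (h₁' : ℕ)
  (hrank' : ∀ n (s : S), (ε'.fixLayer n).hom.finrank s = p ^ (n * h₁'))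
  (φ : Hom B B') (hφ : ∀ n, φ.app n ≫ ε'.app n = ε.app n ≫ φ.app n)

/-- **The restriction `Fix ε → Fix ε′` of a homomorphism `φ : B → B′` commuting with the idempotents** (`φ_n ≫ ε′_n = ε_n ≫ φ_n`):
layers ★ `fixMap (ε_n) (ε′_n) (φ_n)` (homomorphisms, ★ `isMonHom_fixMap`), compatible with the transitions (checked after the
monomorphism `ι′_{n+1}`: both sides are `ι_n ≫ φ_n ≫ incl′ n`). [cite: Tate1967, §2 (2.1)] [cite: GortzWedhorn2020, Definition 4.45 (2) (p. 117)] -/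
def fixRestrict : Hom (ε.fixBTGroup hε h₁ hrank) (ε'.fixBTGroup hε' h₁' hrank') where
  app n :=
    letI := B.grpObj n
    letI := B'.grpObj n
    IdempotentSplitting.fixMap (ε.app n) (ε'.app n) (φ.app n) (hφ n)
  isMonHom_app n := by
    letI := B.grpObj n
    letI := B'.grpObj n
    haveI := B.comm n
    haveI := B'.comm n
    haveI := ε.isMonHom_app n
    haveI := ε'.isMonHom_app n
    haveI := φ.isMonHom_app n
    exact IdempotentSplitting.isMonHom_fixMap (ε.app n) (ε'.app n) (φ.app n) (hφ n)
  incl_comp_app n := by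
    letI := B.grpObj n
    letI := B.grpObj (n + 1)
    letI := B'.grpObj n
    letI := B'.grpObj (n + 1)
    haveI := ε'.mono_fixLayerι (n + 1)
    change ε.fixIncl n ≫ IdempotentSplitting.fixMap (ε.app (n + 1)) (ε'.app (n + 1)) (φ.app (n + 1)) (hφ (n + 1)) =
      IdempotentSplitting.fixMap (ε.app n) (ε'.app n) (φ.app n) (hφ n) ≫ ε'.fixIncl n
    rw [← cancel_mono (ε'.fixLayerι (n + 1)), Category.assoc, Category.assoc, IdempotentSplitting.fixMap_ι,
      ε.fixIncl_ι_assoc, φ.incl_comp_app, ε'.fixIncl_ι, IdempotentSplitting.fixMap_ι_assoc]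

/-- Unfolding: the layers of the restriction are the `fixMap`s. [cite: Tate1967, §2 (2.1)] -/
@[simp] theorem fixRestrict_app (n : ℕ) :
    (fixRestrict ε hε h₁ hrank ε' hε' h₁' hrank' φ hφ).app n =
      letI := B.grpObj n; letI := B'.grpObj n; IdempotentSplitting.fixMap (ε.app n) (ε'.app n) (φ.app n) (hφ n) := rfl

/-- `(res φ)_n ≫ ι′_n = ι_n ≫ φ_n` on the layers. [cite: Tate1967, §2 (2.1)] [cite: GortzWedhorn2020, Definition 4.45 (2) (p. 117)] -/
@[reassoc]
theorem fixRestrict_app_comp_fixLayerι (n : ℕ) :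
    (fixRestrict ε hε h₁ hrank ε' hε' h₁' hrank' φ hφ).app n ≫ ε'.fixLayerι n = ε.fixLayerι n ≫ φ.app n := by
  letI := B.grpObj n
  letI := B'.grpObj n
  exact IdempotentSplitting.fixMap_ι (ε.app n) (ε'.app n) (φ.app n) (hφ n)

/-- **`res φ ≫ ι′ = ι ≫ φ`**: the restriction is compatible with the inclusions. [cite: Tate1967, §2 (2.1)] -/
theorem fixRestrict_comp_fixBTGroupι :
    (fixRestrict ε hε h₁ hrank ε' hε' h₁' hrank' φ hφ).comp (ε'.fixBTGroupι hε' h₁' hrank') =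
      (ε.fixBTGroupι hε h₁ hrank).comp φ := by
  refine Hom.ext fun n => ?_
  rw [comp_app, comp_app, fixBTGroupι_app, fixBTGroupι_app]
  exact fixRestrict_app_comp_fixLayerι ε hε h₁ hrank ε' hε' h₁' hrank' φ hφ n

/-- **`r ≫ res φ = φ ≫ r′`**: the restriction is compatible with the retractions (★ `fixRetract_comp_fixMap`).
[cite: Tate1967, §2 (2.1)] [cite: GortzWedhorn2020, Definition 4.45 (2) (p. 117)] -/
theorem fixBTGroupRetract_comp_fixRestrict :
    (ε.fixBTGroupRetract hε h₁ hrank).comp (fixRestrict ε hε h₁ hrank ε' hε' h₁' hrank' φ hφ) =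
      φ.comp (ε'.fixBTGroupRetract hε' h₁' hrank') := by
  refine Hom.ext fun n => ?_
  letI := B.grpObj n
  letI := B'.grpObj n
  rw [comp_app, comp_app, fixBTGroupRetract_app, fixBTGroupRetract_app, fixRestrict_app]
  exact IdempotentSplitting.fixRetract_comp_fixMap (ε.app n) (ε'.app n) (φ.app n) (hε n) (hε' n) (hφ n)

/-- **`res φ = ι ≫ φ ≫ r′`** (the restriction as «include, apply, project»). [cite: Tate1967, §2 (2.1)] -/
theorem fixRestrict_eq_comp :
    fixRestrict ε hε h₁ hrank ε' hε' h₁' hrank' φ hφ =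
      ((ε.fixBTGroupι hε h₁ hrank).comp φ).comp (ε'.fixBTGroupRetract hε' h₁' hrank') := by
  rw [← fixRestrict_comp_fixBTGroupι ε hε h₁ hrank ε' hε' h₁' hrank' φ hφ, comp_assoc,
    fixBTGroupι_comp_fixBTGroupRetract, comp_id]

end Restrict

/-! ### Functoriality -/

section Functorial

variable (ε : Hom B B) (hε : ∀ n, ε.app n ≫ ε.app n = ε.app n) (h₁ : ℕ)
  (hrank : ∀ n (s : S), (ε.fixLayer n).hom.finrank s = p ^ (n * h₁))
  (ε' : Hom B' B') (hε' : ∀ n, ε'.app n ≫ ε'.app n = ε'.app n) (h₁' : ℕ)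
  (hrank' : ∀ n (s : S), (ε'.fixLayer n).hom.finrank s = p ^ (n * h₁'))
  (ε'' : Hom B'' B'') (hε'' : ∀ n, ε''.app n ≫ ε''.app n = ε''.app n) (h₁'' : ℕ)
  (hrank'' : ∀ n (s : S), (ε''.fixLayer n).hom.finrank s = p ^ (n * h₁''))

/-- The restriction of the identity is the identity. [cite: Tate1967, §2 (2.1)] -/
@[simp] theorem fixRestrict_id :
    fixRestrict ε hε h₁ hrank ε hε h₁ hrank (Hom.id B) (fun n => by rw [id_app, Category.id_comp, Category.comp_id]) =
      Hom.id _ := by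
  apply comp_fixBTGroupι_injective ε hε h₁ hrank
  rw [fixRestrict_comp_fixBTGroupι, comp_id, id_comp]

/-- The restriction of `ε` itself is the identity of `Fix ε` (`ε` acts trivially on its fixed part). [cite: Tate1967, §2 (2.1)] -/
theorem fixRestrict_self :
    fixRestrict ε hε h₁ hrank ε hε h₁ hrank ε (fun _ => rfl) = Hom.id _ := by
  apply comp_fixBTGroupι_injective ε hε h₁ hrank
  rw [fixRestrict_comp_fixBTGroupι, id_comp]
  refine Hom.ext fun n => ?_
  rw [comp_app, fixBTGroupι_app]
  exact ε.fixLayerι_comp n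

/-- **Functoriality**: the restriction of a composite is the composite of the restrictions. [cite: Tate1967, §2 (2.1)] -/
theorem fixRestrict_comp (φ : Hom B B') (hφ : ∀ n, φ.app n ≫ ε'.app n = ε.app n ≫ φ.app n)
    (ψ : Hom B' B'') (hψ : ∀ n, ψ.app n ≫ ε''.app n = ε'.app n ≫ ψ.app n) :
    fixRestrict ε hε h₁ hrank ε'' hε'' h₁'' hrank'' (φ.comp ψ)
        (fun n => by rw [comp_app, Category.assoc, hψ n, ← Category.assoc, hφ n, Category.assoc]) =
      (fixRestrict ε hε h₁ hrank ε' hε' h₁' hrank' φ hφ).comp (fixRestrict ε' hε' h₁' hrank' ε'' hε'' h₁'' hrank'' ψ hψ) := by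
  apply comp_fixBTGroupι_injective ε'' hε'' h₁'' hrank''
  rw [fixRestrict_comp_fixBTGroupι, comp_assoc, fixRestrict_comp_fixBTGroupι, ← comp_assoc, ← comp_assoc,
    fixRestrict_comp_fixBTGroupι]

/-- Two restrictions agree when the homomorphisms do (the proof fields are irrelevant). [cite: Tate1967, §2 (2.1)] -/
theorem fixRestrict_congr {φ ψ : Hom B B'} (hφ : ∀ n, φ.app n ≫ ε'.app n = ε.app n ≫ φ.app n)
    (hψ : ∀ n, ψ.app n ≫ ε'.app n = ε.app n ≫ ψ.app n) (h : φ = ψ) :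
    fixRestrict ε hε h₁ hrank ε' hε' h₁' hrank' φ hφ = fixRestrict ε hε h₁ hrank ε' hε' h₁' hrank' ψ hψ := by
  subst h; rfl

end Functorial

end Hom

end BTGroup

end Literature.AlgebraicGeometry.GroupSchemes

end
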